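import Summits.QuantumFields.YangMills.Theorems.BalabanUVNodesN22AtRecordOfTermDataTableGerms
import Summits.QuantumFields.YangMills.Theorems.BalabanUVNodesN18HLayerW1TermInputs226Chain

/-!
# BalabanUVNodes ∕ node N22 = NE9 — THE N18 → N22 (Adm-run) JUNCTION ON TOP OF THE N10 → N22 JUNCTION (module J68): ROAD 2 at the record for def-W1's (2.14) term
# data read on N10's table-germ carrier, with def-W1's admissibility bookkeeping `RecAdmissible (𝔇 K).Gn (D K) (AdmHist (sp K) E₀ r₁)` DISCHARGED BY NAME from node
# N18's table-based located inputs (`N18HLayerW1TermInputs226Chain.recAdmissible_Gn_of_inputs226Holo`) — trigger (t28) of this lane's map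

Cell `pub-ymgap`, HUMAN RULING D-0062 (Track A), R134 seat `pub-ymgap-dag-n22-c` (strategy s1: «the history-Lipschitz estimate (2.40)–(2.41) p. 21 of [II] on the W1 object»), generation
19, module J70.  THEOREMS ONLY (no `def`, no `sorry`, standard axioms); `--kind proof --supports stmt-QuantumFields-27366 --as helper` (K3⁸ `SpineGivenEndpointR13SepCoPHV`), COUNT-NEUTRAL.
Imports this lane's module J68 `…N22AtRecordOfTermDataTableGerms` (the N10 → N22 junction) and node N18's file 32 `…N18HLayerW1TermInputs226Chain` (seat `pub-ymgap-dag-n18-c` g10: the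
configuration chain of W1's generator `𝔇.Gn` keyed on node00-def-W1's record of located inputs).  Nothing re-declared; both consumed BY NAME.

WHY.  After J68 the older-term side of N22's ROAD 2 at def-W1's term data `(𝔇 K).Gn` consists of def-W1's LAWS, the per-term row `hT` (N10's INTENT-8) and def-W1's admissibility
BOOKKEEPING `RecAdmissible (𝔇 K).Gn (D K) (AdmHist (sp K) E₀ r₁)` — «along every coupling history with values in `D K` the generated older terms of every step obey [I] (1.18) on the
tables and are analytic there», in print an OUTPUT of the construction re-established at each step ([I] p. 263), in def-W1's storey 4 a hypothesis schema «asserted nowhere».  Node N18 HAS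
PROVED IT for exactly this generator: `recAdmissible_Gn_of_inputs226Holo` closes the induction from ONE table-based located record per step, coupling `s ∈ D K`, admissible older-term
table, polymer `Z`, term `t ∈ terms L M Z` and configuration `φ₁` of the located-inputs table `big K (k+1) Z` — a `(𝔇 K k).Inputs226Holo c Z t s old φ₁ a a₅` with its fourteen
regularity ∕ smallness conjuncts (separate holomorphy of NODE A's kernels `A(σ,u)`, `G(σ,u)` in `σ` and in the configuration, holomorphy ∕ measurability of Lemma 2's potentials in the
configuration, symmetry and `Re ≻ 0` of `A`, the (2.20) shape, the (L17a)∕(L16a) kernel bounds) — via Lemma 3's resummation, (1.17)'s margin tables `SpRestr`, and the renewal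
`e·9·64·K₀(64,8)²·C₃ε₁ ≤ E₀`; and its conclusion `RecAdmissible 𝔇.Gn D fun k => {old | (1.18) ∧ analytic}` IS `RecAdmissible 𝔇.Gn D (W1.AdmHist sp E₀ r₁)` by `rfl` (node00-def-W1's
`HistoryAdmissibleClass` typed the class letter for letter for this purpose).  THIS FILE COMPOSES: J68 §2 with `hRA :=` N18's theorem (and J68's `hsmall` from N18's strict clause `hKP`).
* §1 ★★★ `ne9_EA_objectsOfRecord₁₃_of_kernelStepRate_termDataTableGermsLawsN18AdmNonexpansive` — K3's `h9` from: N18's kernel step rate `h5` + (1.21) `hlim`; W1-20's law `hloc` at the run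
  towers of `(𝔇 K).Gn`; open tables `sp K j` ((1.17)-margin `SpRestr (sp K (k+1))`) inside open located-inputs tables `big K (k+1) Z`; N18's located record `hloc18` on coupling
  domains `D K ⊇ ]0, γ]`; def-W1's laws (`UnscaledFieldLawOn`, `ReadsBy`, `MapsToTables` on windows `W ⊇ sp`); PER TERM `hT` (holomorphy ∧ (2.26) weight along the section `cv` on
  `ball 0 R`); `Lemma3Numerics c …` (`8 ≤ L = c.L`, `1 ≤ κ₁`, `α₆ ≠ 0`), `0 ≤ C₃ε₁`, the two [KP86] clauses (strict), `κ ≤ κ_E ≤ r₁`, renewals `… ≤ M_b`, `… ≤ E₀`; level weights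
  `0 < aw ≤ c_w`, `4M_b c_w∕ϱ < 1`, `c_w E₀ + ϱ < R`; the last-coupling sectors `hholS ∕ hbdS` of `((𝔇 K).Gn k).E`; S25's located configuration-chart block; readings ∕ tails ∕ (1.21);
  standing rows ⟹ `NE9 ((objectsOfRecord₁₃ F N θ ℓ).EA 0) (Window θ.γ) ℓ.κ ℓ.moduli`.
* §2 ★★★ socket `n22At_u3OfRecord₁₃_of_kernelStepRate_termDataTableGermsLawsN18AdmNonexpansive` — §1 ⟹ `N22At (u3OfRecord₁₃ θ (objectsOfRecord₁₃ F N θ ℓ) k)` for every run length `k`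
  (dag-n27-c's `h22` row; plug = J68 §3's leaf shape with `hRA` replaced by `big hbigo hrestr hbig … hκ₁ hα₆ … hloc18`, `hsmall` by `hKP`, `+ hrenewE`).
After J70 the older-term side of N22's ROAD 2 at def-W1's term data is: NODE A's located inputs in N18's table-based record form (for (Adm-run)) + def-W1's laws + PER TERM `hT` (N10's
INTENT-8 locates it on ONE record at one admissible history + (2.20) there) — i.e. NODE A records and def-W1 laws only; unchanged: N18's rate, last-coupling sectors, S25's chart block,
readings ∕ tails ∕ law ∕ (1.21), numerics, standing rows.

HONEST FRAMING (binding).  Count-neutral COMPOSITION of tree theorems BY NAME (J68 §2; N18 file 32; def-W1's class by `rfl`); N18's located record, the laws, `hT`, the numerics and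
every other binder are DISPLAYED HYPOTHESES (GAPS G-ne9p2-5 ∕ G-t4-U3-1 now sit in NODE A's records and def-W1's laws); NO estimate of Bałaban's is proved or asserted; nothing of the
record is constructed or claimed to meet the displayed inputs.  N18, N10 and N22 are NOT discharged (typed 28∕28 · discharged 5∕27 UNCHANGED); K3⁸ OPEN and NOT claimed; NE9 ∕ NE5 are
NOT IN PRINT for d = 4; no count claim; one finite 𝕋⁴ programme at fixed ε — R4 closes the CONDITIONAL rung `BalabanLadder.UV` only; NOTHING about the continuum limit, ℝ⁴, infinite
volume, OS axioms, a mass gap or the Clay problem is proved or claimed.  References (TYPES only): [II] = Bałaban, CMP 116 (1988) (1.41) p. 11, (2.14)–(2.15) p. 15, (2.16)–(2.22)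
p. 16, (2.26) p. 17, Lemma 3 (2.38) p. 20, (2.39)–(2.41) p. 21; [I] = CMP 109 (1987) (1.17)–(1.18) p. 263, Thm 1 p. 259, (2.9)–(2.13) pp. 266–268; Kotecký–Preiss, CMP 103 (1986)
Thm p. 492; King, CMP 102 (1986) Lemma 4.5 (4.38).
-/

noncomputable section

open Set Metric
open scoped BigOperators

namespace YMDAG.N22.KernelFading

open Literature.MathematicalPhysics.QuantumFieldTheory.Balaban1983to89
open Literature.MathematicalPhysics.QuantumFieldTheory.Balaban1983to89.T4Continuum (T4Family ULoop)
open Literature.MathematicalPhysics.QuantumFieldTheory.Balaban1983to89.T4OutputRate (Window NE9)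
open Literature.MathematicalPhysics.QuantumFieldTheory.Balaban1983to89.TreeLengthTorus (TPt TDom tsys torusTreeLen)
open Literature.MathematicalPhysics.QuantumFieldTheory.Balaban1983to89.B9Thm37GlueTorus (tdist1)
open Literature.MathematicalPhysics.QuantumFieldTheory.Balaban1983to89.B12TreeDecay (K₀ kappa₀)
open Literature.MathematicalPhysics.QuantumFieldTheory.Balaban1983to89.B12Decay510 (delta1)
open Literature.MathematicalPhysics.QuantumFieldTheory.Balaban1983to89.B12Decay510Window (K₁)
open Literature.MathematicalPhysics.QuantumFieldTheory.Balaban1983to89.B12Decay510Torus (distCT nearT)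
open Literature.MathematicalPhysics.QuantumFieldTheory.Balaban1983to89.B13Lemma3TorusData (TBond)
open Literature.MathematicalPhysics.QuantumFieldTheory.Balaban1983to89.B13Lemma3TorusTerms (terms weight)
open Literature.MathematicalPhysics.QuantumFieldTheory.Balaban1983to89.B13Lemma3TorusSocket (Lemma3Numerics)
open Literature.MathematicalPhysics.QuantumFieldTheory.Balaban1983to89.B13OlderTermsTableGerms (Pot cv ρ)
open Literature.MathematicalPhysics.QuantumFieldTheory.Balaban1983to89.Node00 (Stage13Params Stage13HParams U3Letters₁₁ MatA)
open Literature.MathematicalPhysics.QuantumFieldTheory.Balaban1983to89.Node00.Sect2 (domSys domCount CPair)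
open Literature.MathematicalPhysics.QuantumFieldTheory.Balaban1983to89.Node00.W1
open Literature.MathematicalPhysics.QuantumFieldTheory.Balaban1983to89.Node00.LocalizedSum17 (ReadingMaps Localizes17OfRecord₁₃)
open Literature.MathematicalPhysics.QuantumFieldTheory.Balaban1983to89.Node00.U3OfKernels (histPrefix objectsOfRecord₁₃)
open Literature.MathematicalPhysics.QuantumFieldTheory.Balaban1983to89.Node00.U3KernelLetters (KernelStepRateOfRecord₁₃ PolLimitsExistOfRecord₁₃)
open YMDAG.UVSplit (N22At u3OfRecord₁₃ RateReading₁₃CoPH rateCarriersOfRecord₁₃CoPH)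
open YMDAG.N22.AtKernels (n22At_u3OfRecord₁₃_objectsOfRecord₁₃_iff)
open Summit.QuantumFields.YangMills.BalabanUVNodes.N18HLayerW1TermInputs226Chain (recAdmissible_Gn_of_inputs226Holo)

open scoped Matrix Matrix.Norms.L2Operator

variable (F : T4Family) (N : ℕ) [NeZero N] {𝔸 : Type} [NormedRing 𝔸] [NormedAlgebra ℂ 𝔸]

/-! ## §1 ★★★ K3's `h9`: J68 §2 with (Adm-run) DISCHARGED from node N18's table-based located inputs -/

open Classical Finset in
/-- ★★★ **K3's `h9` ON ROAD 2 FOR def-W1's TERM DATA READ ON N10's TABLE-GERM CARRIER, WITH (Adm-run) FROM NODE N18's TABLE-BASED LOCATED INPUTS** — module J68 §2 with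
def-W1's bookkeeping `RecAdmissible (𝔇 K).Gn (D K) (AdmHist (sp K) E₀ r₁)` DISCHARGED BY NAME by `N18HLayerW1TermInputs226Chain.recAdmissible_Gn_of_inputs226Holo` (conclusion = the
class by `rfl`): per step ∕ coupling `s ∈ D K` ∕ admissible older-term table ∕ polymer ∕ term ∕ configuration of `big K (k+1) Z`, ONE located record `(𝔇 K k).Inputs226Holo c Z t s old
φ₁ a a₅` with its fourteen conjuncts (N18's binder verbatim), (1.17)-margin tables `SpRestr`, `sp ⊆ big` open, `1 ≤ κ₁`, `α₆ ≠ 0`, the strict [KP86] clause, the renewal `… ≤ E₀`; all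
other inputs as in J68 §2 ⟹ **`NE9 ((objectsOfRecord₁₃ F N θ ℓ).EA 0) (Window θ.γ) ℓ.κ ℓ.moduli`**.  LOCATED (hypothesis form); N22 NOT discharged. [folklore] -/
theorem ne9_EA_objectsOfRecord₁₃_of_kernelStepRate_termDataTableGermsLawsN18AdmNonexpansive (θ : Stage13Params F N) (ℓ : U3Letters₁₁) (hs : ℓ.Signs) (hγ : 0 < θ.γ)
    (hlim : PolLimitsExistOfRecord₁₃ F N θ) {κ₅ C₅ : ℝ} (hC₅ : 0 ≤ C₅) (h5 : KernelStepRateOfRecord₁₃ F N θ κ₅ ℓ.θ₅ C₅)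
    (m' : ℕ) (M : ℕ) [NeZero M] (hM : M = F.L ^ m')
    {c₀ : B13.Consts} {L : ℕ} [NeZero L] (𝔇 : (K : ℕ) → TermData214 c₀ (F.P K) 𝔸 M L) (emb : ReadingMaps F (MatA N) 𝔸)
    (hloc : Localizes17OfRecord₁₃ F N θ (fun K => truncRun K (toClusterTower (𝔇 K).Gn)) emb)
    (sp : (K j : ℕ) → (domSys (F.P K) M j).Dom → Set (CPair (F.P K) 𝔸))
    (hsp : ∀ (K j : ℕ) (Y : (domSys (F.P K) M j).Dom), IsOpen (sp K j Y))
    {κ κE δ₀ B₃ r R E₀ ϱ Mb cw cS Bq r₁ : ℝ} {aw : ℕ → ℕ → ℕ → ℝ}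
    (hκ₀ : kappa₀ (4 * 2 ^ 4) (2 * 4) ≤ κ / 2) (hδ₀ : 0 < δ₀) (hB₃ : 0 ≤ B₃) (hr : 0 < r) (hκE : κ ≤ κE) (hE₀ : 0 ≤ E₀)
    (big : (K j : ℕ) → (domSys (F.P K) M j).Dom → Set (CPair (F.P K) 𝔸))
    (hbigo : ∀ (K k : ℕ) (Z : (domSys (F.P K) M (k + 1)).Dom), IsOpen (big K (k + 1) Z))
    (hrestr : ∀ (K k : ℕ), SpRestr (sp K (k + 1))) (hbig : ∀ (K k : ℕ) (Z : (domSys (F.P K) M (k + 1)).Dom), sp K (k + 1) Z ⊆ big K (k + 1) Z)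
    (c : B13.Consts) (hL : 8 ≤ c.L) (hLc : c.L = L) (hκ₁ : 1 ≤ c.κ₁) (hα₆ : c.α₆ ≠ 0) {a a₂ a₂' a₅ Aabs : ℝ} (hN : Lemma3Numerics c M ((c.L : ℝ) / 2) a a₂ a₂' a₅ Aabs)
    {D : ℕ → Set ℂ}
    (hloc18 : ∀ (K k : ℕ), ∀ s ∈ D K, ∀ old : OlderTerms (F.P K) 𝔸 M k,
      (∀ (j : Fin (k + 1)) (Y : (domSys (F.P K) M j).Dom), ∀ ψ ∈ sp K j Y, ‖old j Y ψ‖ ≤ E₀ * Real.exp (-(r₁ * (domSys (F.P K) M j).dj Y))) →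
      (∀ (j : Fin (k + 1)) (Y : (domSys (F.P K) M j).Dom), AnalyticOnNhd ℂ (old j Y) (sp K j Y)) →
      ∀ (Z : (domSys (F.P K) M (k + 1)).Dom), ∀ t ∈ terms L M Z, ∀ φ₁ ∈ big K (k + 1) Z, ∃ ι : (𝔇 K k).Inputs226Holo c Z t s old φ₁ a a₅,
        (∀ φ ∈ big K (k + 1) Z, ∀ i j, DifferentiableOn ℂ (fun σ => (𝔇 K k).A Z t φ σ i j) {σ | ∀ j, σ j ∈ ι.Uσ}) ∧
        (∀ φ ∈ big K (k + 1) Z, ∀ i j, DifferentiableOn ℂ (fun σ => ((𝔇 K k).𝒦 Z t).G2 σ ((𝔇 K k).uOf Z t φ) i j) {σ | ∀ j, σ j ∈ ι.Uσ}) ∧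
        (∀ σ : TPt (F.P K).d (domCount (F.P K) M (k + 1)) → ℂ, (∀ j, σ j ∈ ι.Uσ) → ∀ i j, DifferentiableOn ℂ (fun φ => (𝔇 K k).A Z t φ σ i j) (big K (k + 1) Z)) ∧
        (∀ σ : TPt (F.P K).d (domCount (F.P K) M (k + 1)) → ℂ, (∀ j, σ j ∈ ι.Uσ) →
          ∀ i j, DifferentiableOn ℂ (fun φ => ((𝔇 K k).𝒦 Z t).G2 σ ((𝔇 K k).uOf Z t φ) i j) (big K (k + 1) Z)) ∧
        (∀ Y B, DifferentiableOn ℂ (fun φ => (𝔇 K k).𝒱 Z t s old φ Y B) (big K (k + 1) Z)) ∧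
        (∀ φ ∈ big K (k + 1) Z, ∀ Y, Measurable ((𝔇 K k).𝒱 Z t s old φ Y)) ∧
        (∀ φ ∈ big K (k + 1) Z, ∀ σ : TPt (F.P K).d (domCount (F.P K) M (k + 1)) → ℂ, (∀ j, σ j ∈ ι.Uσ) → ((𝔇 K k).A Z t φ σ).IsSymm) ∧
        (∀ φ ∈ big K (k + 1) Z, ∀ σ : TPt (F.P K).d (domCount (F.P K) M (k + 1)) → ℂ, (∀ j, σ j ∈ ι.Uσ) → (((𝔇 K k).A Z t φ σ).map Complex.re).PosDef) ∧
        (∀ φ ∈ big K (k + 1) Z, ∀ τ : TDom (F.P K).d (L * domCount (F.P K) M (k + 1)) → ℂ, (∀ Y, τ Y ∈ ι.Uτ Y) →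
          ∀ B, ∑ Y ∈ t.1, ‖τ Y‖ * ‖(𝔇 K k).𝒱 Z t s old φ Y B‖ ≤ ι.a₂₀ / 2 * (B ⬝ᵥ B) + ι.w) ∧
        (∀ φ ∈ big K (k + 1) Z, ∀ σ : TPt (F.P K).d (domCount (F.P K) M (k + 1)) → ℂ, (∀ j, σ j ∈ ι.Uσ) → ∀ b j, ‖((𝔇 K k).𝒦 Z t).G2 σ ((𝔇 K k).uOf Z t φ) b j‖ ≤
            ι.KG * Real.exp (-(ι.kap * tdist1 (𝔇 K k).Nf (((𝔇 K k).𝒦 Z t).locΛ b) (((𝔇 K k).𝒦 Z t).locN j)))) ∧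
        (∀ φ ∈ big K (k + 1) Z, ∀ σ : TPt (F.P K).d (domCount (F.P K) M (k + 1)) → ℂ, (∀ j, σ j ∈ ι.Uσ) → ∀ b b', ‖((𝔇 K k).A Z t φ σ)⁻¹ b b'‖ ≤
            ι.KCs * Real.exp (-(ι.kap * tdist1 (𝔇 K k).Nf (((𝔇 K k).𝒦 Z t).locΛ b) (((𝔇 K k).𝒦 Z t).locΛ b')))) ∧
        (∀ φ ∈ big K (k + 1) Z, ∀ σ : TPt (F.P K).d (domCount (F.P K) M (k + 1)) → ℂ, (∀ j, σ j ∈ ι.Uσ) →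
          ∀ b j, ‖(((𝔇 K k).𝒦 Z t).G2 σ ((𝔇 K k).uOf Z t φ) - ((𝔇 K k).𝒦 Z t).Γ₀.map (algebraMap ℝ ℂ)) b j‖ ≤
            ι.θΓ * Real.exp (-(ι.kap * tdist1 (𝔇 K k).Nf (((𝔇 K k).𝒦 Z t).locΛ b) (((𝔇 K k).𝒦 Z t).locN j)))) ∧
        (∀ φ ∈ big K (k + 1) Z, ∀ σ : TPt (F.P K).d (domCount (F.P K) M (k + 1)) → ℂ, (∀ j, σ j ∈ ι.Uσ) →
          ∀ b b', ‖(((𝔇 K k).A Z t φ σ)⁻¹ - ((𝔇 K k).𝒦 Z t).C.map (algebraMap ℝ ℂ)) b b'‖ ≤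
            ι.θC * Real.exp (-(ι.kap * tdist1 (𝔇 K k).Nf (((𝔇 K k).𝒦 Z t).locΛ b) (((𝔇 K k).𝒦 Z t).locΛ b')))) ∧
        (∀ φ ∈ big K (k + 1) Z, ∀ σ : TPt (F.P K).d (domCount (F.P K) M (k + 1)) → ℂ, (∀ j, σ j ∈ ι.Uσ) →
          ∀ b b', ‖((𝔇 K k).A Z t φ σ - ((𝔇 K k).𝒦 Z t).C⁻¹.map (algebraMap ℝ ℂ)) b b'‖ ≤
            ι.θE * Real.exp (-(ι.kap * tdist1 (𝔇 K k).Nf (((𝔇 K k).𝒦 Z t).locΛ b) (((𝔇 K k).𝒦 Z t).locΛ b')))))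
    (hD : ∀ K, ∀ t ∈ Ioc (0 : ℝ) θ.γ, ((t : ℝ) : ℂ) ∈ D K)
    {S : ℕ → ℕ → Type} [∀ K k, MeasurableSpace (S K k)]
    (χu χcu : (K k : ℕ) → (𝔇 K k).UnscaledChi) (𝒲 : (K k : ℕ) → (𝔇 K k).UnscaledWilson) (𝒪 : (K k : ℕ) → (𝔇 K k).UnscaledOlder)
    (Rd : (K k : ℕ) → (Z : (domSys (F.P K) M (k + 1)).Dom) → (t : TermLabel (F.P K) M k L) → (𝔇 K k).ReadingAtoms Z t (S K k))
    (W : (K k : ℕ) → (domSys (F.P K) M (k + 1)).Dom → TermLabel (F.P K) M k L → Set (CPair (F.P K) 𝔸))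
    (hlaw : ∀ K, (𝔇 K).UnscaledFieldLawOn (χu K) (χcu K) (𝒲 K) (𝒪 K) θ.γ) (hread : ∀ K k, (𝔇 K k).ReadsBy (𝒪 K k) (Rd K k))
    (hmaps : ∀ (K k : ℕ) (Z : (domSys (F.P K) M (k + 1)).Dom) (t : TermLabel (F.P K) M k L), (Rd K k Z t).MapsToTables (sp K) (W K k Z t) univ)
    (hW : ∀ (K k : ℕ) (X Z : (domSys (F.P K) M (k + 1)).Dom), Subtype.val Z ⊆ Subtype.val X → ∀ s ∈ terms L M Z, sp K (k + 1) X ⊆ W K k Z s)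
    (hT : ∀ (K k : ℕ), ∀ t ∈ Ioc (0 : ℝ) θ.γ, ∀ (X : (domSys (F.P K) M (k + 1)).Dom), ∀ φ ∈ sp K (k + 1) X,
      ∀ Z : (domSys (F.P K) M (k + 1)).Dom, Subtype.val Z ⊆ Subtype.val X → ∀ s ∈ terms L M Z,
        DifferentiableOn ℂ (fun p : Pot k (sp K) => (𝔇 K k).TF Z s ((t : ℝ) : ℂ) (cv κE (fun j : Fin (k + 1) => aw K k j) p) φ) (ball 0 R) ∧
          ∀ p ∈ ball (0 : Pot k (sp K)) R,
            ‖(𝔇 K k).TF Z s ((t : ℝ) : ℂ) (cv κE (fun j : Fin (k + 1) => aw K k j) p) φ‖ ≤ weight L M c Z a s * Real.exp (a₅ * ((Z.1).card : ℝ)))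
    (hA0 : 0 ≤ c.C3act * c.ε₁) (hr₁ : 0 ≤ r₁) (hrate : r₁ + 2 * (64 * Real.log 162) + 2 ≤ (1 - 8 * c.δ) * ((c.L : ℝ) / 2) * c.κ)
    (hKP : c.C3act * c.ε₁ * Real.exp (5 * r₁ + 1) * K₀ 64 8 * 9 * 64 < 1) (hκr : κE ≤ r₁) (hrenew : Real.exp 1 * 9 * 64 * K₀ 64 8 ^ 2 * (c.C3act * c.ε₁) ≤ Mb)
    (hrenewE : Real.exp 1 * 9 * 64 * K₀ 64 8 ^ 2 * (c.C3act * c.ε₁) ≤ E₀)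
    (hawpos : ∀ K k j, 0 < aw K k j) (hawcw : ∀ K k j, aw K k j ≤ cw) (hC1 : 4 * Mb * cw / ϱ < 1)
    (hMb0 : 0 ≤ Mb) (hϱ : 0 < ϱ) (hR : cw * E₀ + ϱ < R)
    (O : ℕ → Set ℂ) (V : (K k : ℕ) → OlderTerms (F.P K) 𝔸 M k → CPair (F.P K) 𝔸 → (domSys (F.P K) M (k + 1)).Dom → ℂ) (hcS : 0 < cS) (hBq : 0 ≤ Bq)
    (hballS : ∀ K, ∀ s ∈ Ioc (0 : ℝ) θ.γ, closedBall (s : ℂ) (cS * s) ⊆ O K)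
    (hholS : ∀ (K k : ℕ) (old : OlderTerms (F.P K) 𝔸 M k), old ∈ AdmHist (sp K) E₀ r₁ k ∧ old 0 = 0 → ∀ (X : (domSys (F.P K) M (k + 1)).Dom), ∀ φ ∈ sp K (k + 1) X,
      DifferentiableOn ℂ (fun z => ((𝔇 K).Gn k).E z old φ X) (O K))
    (hbdS : ∀ (K k : ℕ) (old : OlderTerms (F.P K) 𝔸 M k), old ∈ AdmHist (sp K) E₀ r₁ k ∧ old 0 = 0 → ∀ (X : (domSys (F.P K) M (k + 1)).Dom), ∀ φ ∈ sp K (k + 1) X,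
      ∀ s ∈ Ioc (0 : ℝ) θ.γ, ∀ z ∈ closedBall (s : ℂ) (cS * s),
        ‖((𝔇 K).Gn k).E z old φ X - V K k old φ X‖ ≤ Bq * Real.exp (-(κE * (domSys (F.P K) M (k + 1)).dj X)) * s ^ 2)
    (Ec : ℕ → ℕ → Type*) [∀ K k, NormedAddCommGroup (Ec K k)] [∀ K k, NormedSpace ℂ (Ec K k)]
    (ι : letI := θ.instVβ₁; letI := θ.instVβ₂
      (K k : ℕ) → (domSys (F.P K) M (k + 1)).Dom → ((Fin (F.P K).d → Site (F.P K) (k + 1) → θ.Vβ) →L[ℝ] Ec K k))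
    (Φ : (K k : ℕ) → (domSys (F.P K) M (k + 1)).Dom → Ec K k → CPair (F.P K) 𝔸)
    (U : (K k : ℕ) → (domSys (F.P K) M (k + 1)).Dom → Set (Ec K k)) (hU : ∀ K k X, IsOpen (U K k X)) (hrU : ∀ K k X, ball (0 : Ec K k) r ⊆ U K k X)
    (hEhol : ∀ g ∈ Window θ.γ, ∀ (K k : ℕ) (X : (domSys (F.P K) M (k + 1)).Dom),
      DifferentiableOn ℂ (fun z => (truncRun K (toClusterTower (𝔇 K).Gn) k).E (histPrefix g k) (Φ K k X z) X) (U K k X))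
    (hΦemb : letI := θ.instVβ₁; letI := θ.instVβ₂
      ∀ (K k : ℕ) (X : (domSys (F.P K) M (k + 1)).Dom) (Bf : Fin (F.P K).d → Site (F.P K) (k + 1) → θ.Vβ),
        Φ K k X (ι K k X Bf) = emb K k (fun l t => NormedSpace.exp (θ.ρ8 (Bf l t))))
    (hΦsp : ∀ (K k : ℕ) (X : (domSys (F.P K) M (k + 1)).Dom), ∀ z ∈ ball (0 : Ec K k) r, Φ K k X z ∈ sp K (k + 1) X)
    (w : (K k : ℕ) → (domSys (F.P K) M (k + 1)).Dom → Site (F.P K) (k + 1) → ℝ) (hw₀ : ∀ K k X t, 0 ≤ w K k X t)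
    (hw : letI := θ.instVβ₁; letI := θ.instVβ₂; letI := θ.instιβ
      ∀ (K k : ℕ) (X : (domSys (F.P K) M (k + 1)).Dom) (l : Fin (F.P K).d) (t : Site (F.P K) (k + 1)) (c : θ.ιβ),
        ‖ι K k X (Pi.single l (Pi.single t (θ.bV c)))‖ ≤ w K k X t)
    (htail : ∀ (K k : ℕ) (X : (domSys (F.P K) M (k + 1)).Dom) (t : Site (F.P K) (k + 1)),
      let e : Site (F.P K) (k + 1) → TPt 4 (domCount (F.P K) M (k + 1) * M) := fun x i => (ZMod.cast (x i) : ZMod (domCount (F.P K) M (k + 1) * M))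
      w K k X t ≤ B₃ * Real.exp (-δ₀ * distCT (domCount (F.P K) M (k + 1)) M (e t) (nearT (M := M) (e t) X)))
    (hκ₅ : delta1 δ₀ κ ((M : ℝ) * 4) ≤ κ₅)
    (hω : 0 < ℓ.ω) (hθω : ℓ.θ₅ ≤ ℓ.ω ^ 2) (hℓκ : ℓ.κ ≤ delta1 δ₀ κ ((M : ℝ) * 4))
    (hC₉ : (4 * (2 * C₅ / (1 - ℓ.θ₅) + 2 * ((16 * Mb * B₃ ^ 2 / r ^ 2) * Real.exp (delta1 δ₀ κ ((M : ℝ) * 4) * ((M : ℝ) * 4) * 3) * K₀ (4 * 2 ^ 4) (2 * 4) * K₁ 4 (δ₀ / 2))) / θ.γ +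
        ((16 * max ((6 * cS ^ 2 + 32 * cS + 64) / cS ^ 2 * Bq) (64 * Mb * cw ^ 2 / ϱ ^ 2 * (Bq * θ.γ / cS) ^ 2 / (1 - 4 * Mb * cw / ϱ)) * B₃ ^ 2 / r ^ 2) * Real.exp (delta1 δ₀ κ ((M : ℝ) * 4) * ((M : ℝ) * 4) * 3) * K₀ (4 * 2 ^ 4) (2 * 4) *
          K₁ 4 (δ₀ / 2)) * θ.γ / 2) / ℓ.ω ≤ ℓ.C₉) :
    NE9 ((objectsOfRecord₁₃ F N θ ℓ).EA 0) (Window θ.γ) ℓ.κ ℓ.moduli :=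
  ne9_EA_objectsOfRecord₁₃_of_kernelStepRate_termDataTableGermsLawsNonexpansive F N
    θ ℓ hs hγ hlim hC₅ h5 m' M hM 𝔇 emb hloc sp hsp hκ₀ hδ₀ hB₃ hr hκE hE₀
    (fun K => recAdmissible_Gn_of_inputs226Holo F K L (𝔇 K) (D K) (sp K) (big K) (hbigo K) hκ₁ hα₆ (hloc18 K) (hrestr K) hL hLc hN (hbig K) hr₁ hA0 hrate hKP
        hrenewE)
    hD χu χcu 𝒲 𝒪 Rd W hlaw hread hmaps hW c hL hLc hN hT hA0 hr₁ hrate hKP.le hκr hrenew hawpos hawcw hC1 hMb0 hϱ hR O V hcS hBq hballS hholS hbdS Ec ι Φ U hU hrU hEhol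
    hΦemb hΦsp w hw₀ hw htail hκ₅ hω hθω hℓκ hC₉

/-! ## §2 ★★★ The kernel-face socket -/

open Classical Finset in
/-- ★★★ **THE KERNEL-FACE SOCKET, N18-(Adm-run) EDITION** — §1's inputs ⟹ **`N22At (u3OfRecord₁₃ θ (objectsOfRecord₁₃ F N θ ℓ) k)` for EVERY run length `k`** (dag-n27-c's
`h22` row).  LOCATED (hypothesis form); N22 NOT discharged. [folklore] -/
theorem n22At_u3OfRecord₁₃_of_kernelStepRate_termDataTableGermsLawsN18AdmNonexpansive (θ : Stage13Params F N) (ℓ : U3Letters₁₁) (hs : ℓ.Signs) (hγ : 0 < θ.γ)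
    (hlim : PolLimitsExistOfRecord₁₃ F N θ) {κ₅ C₅ : ℝ} (hC₅ : 0 ≤ C₅) (h5 : KernelStepRateOfRecord₁₃ F N θ κ₅ ℓ.θ₅ C₅)
    (m' : ℕ) (M : ℕ) [NeZero M] (hM : M = F.L ^ m')
    {c₀ : B13.Consts} {L : ℕ} [NeZero L] (𝔇 : (K : ℕ) → TermData214 c₀ (F.P K) 𝔸 M L) (emb : ReadingMaps F (MatA N) 𝔸)
    (hloc : Localizes17OfRecord₁₃ F N θ (fun K => truncRun K (toClusterTower (𝔇 K).Gn)) emb)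
    (sp : (K j : ℕ) → (domSys (F.P K) M j).Dom → Set (CPair (F.P K) 𝔸))
    (hsp : ∀ (K j : ℕ) (Y : (domSys (F.P K) M j).Dom), IsOpen (sp K j Y))
    {κ κE δ₀ B₃ r R E₀ ϱ Mb cw cS Bq r₁ : ℝ} {aw : ℕ → ℕ → ℕ → ℝ}
    (hκ₀ : kappa₀ (4 * 2 ^ 4) (2 * 4) ≤ κ / 2) (hδ₀ : 0 < δ₀) (hB₃ : 0 ≤ B₃) (hr : 0 < r) (hκE : κ ≤ κE) (hE₀ : 0 ≤ E₀)
    (big : (K j : ℕ) → (domSys (F.P K) M j).Dom → Set (CPair (F.P K) 𝔸))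
    (hbigo : ∀ (K k : ℕ) (Z : (domSys (F.P K) M (k + 1)).Dom), IsOpen (big K (k + 1) Z))
    (hrestr : ∀ (K k : ℕ), SpRestr (sp K (k + 1))) (hbig : ∀ (K k : ℕ) (Z : (domSys (F.P K) M (k + 1)).Dom), sp K (k + 1) Z ⊆ big K (k + 1) Z)
    (c : B13.Consts) (hL : 8 ≤ c.L) (hLc : c.L = L) (hκ₁ : 1 ≤ c.κ₁) (hα₆ : c.α₆ ≠ 0) {a a₂ a₂' a₅ Aabs : ℝ} (hN : Lemma3Numerics c M ((c.L : ℝ) / 2) a a₂ a₂' a₅ Aabs)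
    {D : ℕ → Set ℂ}
    (hloc18 : ∀ (K k : ℕ), ∀ s ∈ D K, ∀ old : OlderTerms (F.P K) 𝔸 M k,
      (∀ (j : Fin (k + 1)) (Y : (domSys (F.P K) M j).Dom), ∀ ψ ∈ sp K j Y, ‖old j Y ψ‖ ≤ E₀ * Real.exp (-(r₁ * (domSys (F.P K) M j).dj Y))) →
      (∀ (j : Fin (k + 1)) (Y : (domSys (F.P K) M j).Dom), AnalyticOnNhd ℂ (old j Y) (sp K j Y)) →
      ∀ (Z : (domSys (F.P K) M (k + 1)).Dom), ∀ t ∈ terms L M Z, ∀ φ₁ ∈ big K (k + 1) Z, ∃ ι : (𝔇 K k).Inputs226Holo c Z t s old φ₁ a a₅,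
        (∀ φ ∈ big K (k + 1) Z, ∀ i j, DifferentiableOn ℂ (fun σ => (𝔇 K k).A Z t φ σ i j) {σ | ∀ j, σ j ∈ ι.Uσ}) ∧
        (∀ φ ∈ big K (k + 1) Z, ∀ i j, DifferentiableOn ℂ (fun σ => ((𝔇 K k).𝒦 Z t).G2 σ ((𝔇 K k).uOf Z t φ) i j) {σ | ∀ j, σ j ∈ ι.Uσ}) ∧
        (∀ σ : TPt (F.P K).d (domCount (F.P K) M (k + 1)) → ℂ, (∀ j, σ j ∈ ι.Uσ) → ∀ i j, DifferentiableOn ℂ (fun φ => (𝔇 K k).A Z t φ σ i j) (big K (k + 1) Z)) ∧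
        (∀ σ : TPt (F.P K).d (domCount (F.P K) M (k + 1)) → ℂ, (∀ j, σ j ∈ ι.Uσ) →
          ∀ i j, DifferentiableOn ℂ (fun φ => ((𝔇 K k).𝒦 Z t).G2 σ ((𝔇 K k).uOf Z t φ) i j) (big K (k + 1) Z)) ∧
        (∀ Y B, DifferentiableOn ℂ (fun φ => (𝔇 K k).𝒱 Z t s old φ Y B) (big K (k + 1) Z)) ∧
        (∀ φ ∈ big K (k + 1) Z, ∀ Y, Measurable ((𝔇 K k).𝒱 Z t s old φ Y)) ∧
        (∀ φ ∈ big K (k + 1) Z, ∀ σ : TPt (F.P K).d (domCount (F.P K) M (k + 1)) → ℂ, (∀ j, σ j ∈ ι.Uσ) → ((𝔇 K k).A Z t φ σ).IsSymm) ∧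
        (∀ φ ∈ big K (k + 1) Z, ∀ σ : TPt (F.P K).d (domCount (F.P K) M (k + 1)) → ℂ, (∀ j, σ j ∈ ι.Uσ) → (((𝔇 K k).A Z t φ σ).map Complex.re).PosDef) ∧
        (∀ φ ∈ big K (k + 1) Z, ∀ τ : TDom (F.P K).d (L * domCount (F.P K) M (k + 1)) → ℂ, (∀ Y, τ Y ∈ ι.Uτ Y) →
          ∀ B, ∑ Y ∈ t.1, ‖τ Y‖ * ‖(𝔇 K k).𝒱 Z t s old φ Y B‖ ≤ ι.a₂₀ / 2 * (B ⬝ᵥ B) + ι.w) ∧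
        (∀ φ ∈ big K (k + 1) Z, ∀ σ : TPt (F.P K).d (domCount (F.P K) M (k + 1)) → ℂ, (∀ j, σ j ∈ ι.Uσ) → ∀ b j, ‖((𝔇 K k).𝒦 Z t).G2 σ ((𝔇 K k).uOf Z t φ) b j‖ ≤
            ι.KG * Real.exp (-(ι.kap * tdist1 (𝔇 K k).Nf (((𝔇 K k).𝒦 Z t).locΛ b) (((𝔇 K k).𝒦 Z t).locN j)))) ∧
        (∀ φ ∈ big K (k + 1) Z, ∀ σ : TPt (F.P K).d (domCount (F.P K) M (k + 1)) → ℂ, (∀ j, σ j ∈ ι.Uσ) → ∀ b b', ‖((𝔇 K k).A Z t φ σ)⁻¹ b b'‖ ≤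
            ι.KCs * Real.exp (-(ι.kap * tdist1 (𝔇 K k).Nf (((𝔇 K k).𝒦 Z t).locΛ b) (((𝔇 K k).𝒦 Z t).locΛ b')))) ∧
        (∀ φ ∈ big K (k + 1) Z, ∀ σ : TPt (F.P K).d (domCount (F.P K) M (k + 1)) → ℂ, (∀ j, σ j ∈ ι.Uσ) →
          ∀ b j, ‖(((𝔇 K k).𝒦 Z t).G2 σ ((𝔇 K k).uOf Z t φ) - ((𝔇 K k).𝒦 Z t).Γ₀.map (algebraMap ℝ ℂ)) b j‖ ≤
            ι.θΓ * Real.exp (-(ι.kap * tdist1 (𝔇 K k).Nf (((𝔇 K k).𝒦 Z t).locΛ b) (((𝔇 K k).𝒦 Z t).locN j)))) ∧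
        (∀ φ ∈ big K (k + 1) Z, ∀ σ : TPt (F.P K).d (domCount (F.P K) M (k + 1)) → ℂ, (∀ j, σ j ∈ ι.Uσ) →
          ∀ b b', ‖(((𝔇 K k).A Z t φ σ)⁻¹ - ((𝔇 K k).𝒦 Z t).C.map (algebraMap ℝ ℂ)) b b'‖ ≤
            ι.θC * Real.exp (-(ι.kap * tdist1 (𝔇 K k).Nf (((𝔇 K k).𝒦 Z t).locΛ b) (((𝔇 K k).𝒦 Z t).locΛ b')))) ∧
        (∀ φ ∈ big K (k + 1) Z, ∀ σ : TPt (F.P K).d (domCount (F.P K) M (k + 1)) → ℂ, (∀ j, σ j ∈ ι.Uσ) →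
          ∀ b b', ‖((𝔇 K k).A Z t φ σ - ((𝔇 K k).𝒦 Z t).C⁻¹.map (algebraMap ℝ ℂ)) b b'‖ ≤
            ι.θE * Real.exp (-(ι.kap * tdist1 (𝔇 K k).Nf (((𝔇 K k).𝒦 Z t).locΛ b) (((𝔇 K k).𝒦 Z t).locΛ b')))))
    (hD : ∀ K, ∀ t ∈ Ioc (0 : ℝ) θ.γ, ((t : ℝ) : ℂ) ∈ D K)
    {S : ℕ → ℕ → Type} [∀ K k, MeasurableSpace (S K k)]
    (χu χcu : (K k : ℕ) → (𝔇 K k).UnscaledChi) (𝒲 : (K k : ℕ) → (𝔇 K k).UnscaledWilson) (𝒪 : (K k : ℕ) → (𝔇 K k).UnscaledOlder)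
    (Rd : (K k : ℕ) → (Z : (domSys (F.P K) M (k + 1)).Dom) → (t : TermLabel (F.P K) M k L) → (𝔇 K k).ReadingAtoms Z t (S K k))
    (W : (K k : ℕ) → (domSys (F.P K) M (k + 1)).Dom → TermLabel (F.P K) M k L → Set (CPair (F.P K) 𝔸))
    (hlaw : ∀ K, (𝔇 K).UnscaledFieldLawOn (χu K) (χcu K) (𝒲 K) (𝒪 K) θ.γ) (hread : ∀ K k, (𝔇 K k).ReadsBy (𝒪 K k) (Rd K k))
    (hmaps : ∀ (K k : ℕ) (Z : (domSys (F.P K) M (k + 1)).Dom) (t : TermLabel (F.P K) M k L), (Rd K k Z t).MapsToTables (sp K) (W K k Z t) univ)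
    (hW : ∀ (K k : ℕ) (X Z : (domSys (F.P K) M (k + 1)).Dom), Subtype.val Z ⊆ Subtype.val X → ∀ s ∈ terms L M Z, sp K (k + 1) X ⊆ W K k Z s)
    (hT : ∀ (K k : ℕ), ∀ t ∈ Ioc (0 : ℝ) θ.γ, ∀ (X : (domSys (F.P K) M (k + 1)).Dom), ∀ φ ∈ sp K (k + 1) X,
      ∀ Z : (domSys (F.P K) M (k + 1)).Dom, Subtype.val Z ⊆ Subtype.val X → ∀ s ∈ terms L M Z,
        DifferentiableOn ℂ (fun p : Pot k (sp K) => (𝔇 K k).TF Z s ((t : ℝ) : ℂ) (cv κE (fun j : Fin (k + 1) => aw K k j) p) φ) (ball 0 R) ∧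
          ∀ p ∈ ball (0 : Pot k (sp K)) R,
            ‖(𝔇 K k).TF Z s ((t : ℝ) : ℂ) (cv κE (fun j : Fin (k + 1) => aw K k j) p) φ‖ ≤ weight L M c Z a s * Real.exp (a₅ * ((Z.1).card : ℝ)))
    (hA0 : 0 ≤ c.C3act * c.ε₁) (hr₁ : 0 ≤ r₁) (hrate : r₁ + 2 * (64 * Real.log 162) + 2 ≤ (1 - 8 * c.δ) * ((c.L : ℝ) / 2) * c.κ)
    (hKP : c.C3act * c.ε₁ * Real.exp (5 * r₁ + 1) * K₀ 64 8 * 9 * 64 < 1) (hκr : κE ≤ r₁) (hrenew : Real.exp 1 * 9 * 64 * K₀ 64 8 ^ 2 * (c.C3act * c.ε₁) ≤ Mb)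
    (hrenewE : Real.exp 1 * 9 * 64 * K₀ 64 8 ^ 2 * (c.C3act * c.ε₁) ≤ E₀)
    (hawpos : ∀ K k j, 0 < aw K k j) (hawcw : ∀ K k j, aw K k j ≤ cw) (hC1 : 4 * Mb * cw / ϱ < 1)
    (hMb0 : 0 ≤ Mb) (hϱ : 0 < ϱ) (hR : cw * E₀ + ϱ < R)
    (O : ℕ → Set ℂ) (V : (K k : ℕ) → OlderTerms (F.P K) 𝔸 M k → CPair (F.P K) 𝔸 → (domSys (F.P K) M (k + 1)).Dom → ℂ) (hcS : 0 < cS) (hBq : 0 ≤ Bq)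
    (hballS : ∀ K, ∀ s ∈ Ioc (0 : ℝ) θ.γ, closedBall (s : ℂ) (cS * s) ⊆ O K)
    (hholS : ∀ (K k : ℕ) (old : OlderTerms (F.P K) 𝔸 M k), old ∈ AdmHist (sp K) E₀ r₁ k ∧ old 0 = 0 → ∀ (X : (domSys (F.P K) M (k + 1)).Dom), ∀ φ ∈ sp K (k + 1) X,
      DifferentiableOn ℂ (fun z => ((𝔇 K).Gn k).E z old φ X) (O K))
    (hbdS : ∀ (K k : ℕ) (old : OlderTerms (F.P K) 𝔸 M k), old ∈ AdmHist (sp K) E₀ r₁ k ∧ old 0 = 0 → ∀ (X : (domSys (F.P K) M (k + 1)).Dom), ∀ φ ∈ sp K (k + 1) X,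
      ∀ s ∈ Ioc (0 : ℝ) θ.γ, ∀ z ∈ closedBall (s : ℂ) (cS * s),
        ‖((𝔇 K).Gn k).E z old φ X - V K k old φ X‖ ≤ Bq * Real.exp (-(κE * (domSys (F.P K) M (k + 1)).dj X)) * s ^ 2)
    (Ec : ℕ → ℕ → Type*) [∀ K k, NormedAddCommGroup (Ec K k)] [∀ K k, NormedSpace ℂ (Ec K k)]
    (ι : letI := θ.instVβ₁; letI := θ.instVβ₂
      (K k : ℕ) → (domSys (F.P K) M (k + 1)).Dom → ((Fin (F.P K).d → Site (F.P K) (k + 1) → θ.Vβ) →L[ℝ] Ec K k))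
    (Φ : (K k : ℕ) → (domSys (F.P K) M (k + 1)).Dom → Ec K k → CPair (F.P K) 𝔸)
    (U : (K k : ℕ) → (domSys (F.P K) M (k + 1)).Dom → Set (Ec K k)) (hU : ∀ K k X, IsOpen (U K k X)) (hrU : ∀ K k X, ball (0 : Ec K k) r ⊆ U K k X)
    (hEhol : ∀ g ∈ Window θ.γ, ∀ (K k : ℕ) (X : (domSys (F.P K) M (k + 1)).Dom),
      DifferentiableOn ℂ (fun z => (truncRun K (toClusterTower (𝔇 K).Gn) k).E (histPrefix g k) (Φ K k X z) X) (U K k X))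
    (hΦemb : letI := θ.instVβ₁; letI := θ.instVβ₂
      ∀ (K k : ℕ) (X : (domSys (F.P K) M (k + 1)).Dom) (Bf : Fin (F.P K).d → Site (F.P K) (k + 1) → θ.Vβ),
        Φ K k X (ι K k X Bf) = emb K k (fun l t => NormedSpace.exp (θ.ρ8 (Bf l t))))
    (hΦsp : ∀ (K k : ℕ) (X : (domSys (F.P K) M (k + 1)).Dom), ∀ z ∈ ball (0 : Ec K k) r, Φ K k X z ∈ sp K (k + 1) X)
    (w : (K k : ℕ) → (domSys (F.P K) M (k + 1)).Dom → Site (F.P K) (k + 1) → ℝ) (hw₀ : ∀ K k X t, 0 ≤ w K k X t)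
    (hw : letI := θ.instVβ₁; letI := θ.instVβ₂; letI := θ.instιβ
      ∀ (K k : ℕ) (X : (domSys (F.P K) M (k + 1)).Dom) (l : Fin (F.P K).d) (t : Site (F.P K) (k + 1)) (c : θ.ιβ),
        ‖ι K k X (Pi.single l (Pi.single t (θ.bV c)))‖ ≤ w K k X t)
    (htail : ∀ (K k : ℕ) (X : (domSys (F.P K) M (k + 1)).Dom) (t : Site (F.P K) (k + 1)),
      let e : Site (F.P K) (k + 1) → TPt 4 (domCount (F.P K) M (k + 1) * M) := fun x i => (ZMod.cast (x i) : ZMod (domCount (F.P K) M (k + 1) * M))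
      w K k X t ≤ B₃ * Real.exp (-δ₀ * distCT (domCount (F.P K) M (k + 1)) M (e t) (nearT (M := M) (e t) X)))
    (hκ₅ : delta1 δ₀ κ ((M : ℝ) * 4) ≤ κ₅)
    (hω : 0 < ℓ.ω) (hθω : ℓ.θ₅ ≤ ℓ.ω ^ 2) (hℓκ : ℓ.κ ≤ delta1 δ₀ κ ((M : ℝ) * 4))
    (hC₉ : (4 * (2 * C₅ / (1 - ℓ.θ₅) + 2 * ((16 * Mb * B₃ ^ 2 / r ^ 2) * Real.exp (delta1 δ₀ κ ((M : ℝ) * 4) * ((M : ℝ) * 4) * 3) * K₀ (4 * 2 ^ 4) (2 * 4) * K₁ 4 (δ₀ / 2))) / θ.γ +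
        ((16 * max ((6 * cS ^ 2 + 32 * cS + 64) / cS ^ 2 * Bq) (64 * Mb * cw ^ 2 / ϱ ^ 2 * (Bq * θ.γ / cS) ^ 2 / (1 - 4 * Mb * cw / ϱ)) * B₃ ^ 2 / r ^ 2) * Real.exp (delta1 δ₀ κ ((M : ℝ) * 4) * ((M : ℝ) * 4) * 3) * K₀ (4 * 2 ^ 4) (2 * 4) *
          K₁ 4 (δ₀ / 2)) * θ.γ / 2) / ℓ.ω ≤ ℓ.C₉) (k : ℕ) :
    N22At (u3OfRecord₁₃ θ (objectsOfRecord₁₃ F N θ ℓ) k) :=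
  (n22At_u3OfRecord₁₃_objectsOfRecord₁₃_iff F N θ ℓ hs k).2
    (ne9_EA_objectsOfRecord₁₃_of_kernelStepRate_termDataTableGermsLawsN18AdmNonexpansive F N
      θ ℓ hs hγ hlim hC₅ h5 m' M hM 𝔇 emb hloc sp hsp hκ₀ hδ₀ hB₃ hr hκE hE₀ big hbigo hrestr hbig c hL hLc hκ₁ hα₆ hN hloc18 hD χu χcu 𝒲 𝒪 Rd W hlaw hread hmaps hW hT
      hA0 hr₁ hrate hKP hκr hrenew hrenewE hawpos hawcw hC1 hMb0 hϱ hR O V hcS hBq hballS hholS hbdS Ec ι Φ U hU hrU hEhol hΦemb hΦsp w hw₀ hw htail hκ₅ hω hθω hℓκ hC₉)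

end YMDAG.N22.KernelFading

end
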